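import Summits.PneNP.PneNP.Theorems.ChebyshevTracialDesignGammaDirectionDischarged
import Summits.PneNP.PneNP.Theorems.ChebyshevTracialDesignGammaDirectionExpTools
import Literature.Combinatorics.Optimization.ShellLawTail
import Literature.Combinatorics.Optimization.ShellLawLineSection
import Literature.Combinatorics.Optimization.ShellLawWindowLowerBoundAFree
import HarnessLib

/-!
# Cell pnp-psdrank, route `ChebyshevTracialDesign`: the γ-direction value bound ON THE FLOORED DEVIATION WINDOW, the two floors
# discharged by the Literature turnkeys, the tail in exponential form — brick 143w (crux `TracialDecayExp20`, stmt-PneNP-19878)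

Brick 143w (prover g29; MEMO-31 §6, first half of brick 143). Brick 142 (`…GammaDirectionDischarged.gammaDirection_value_le_discharged`)
holds for ANY integer window set `B ⊆ [2D+4, 2s+1] ∩ {|y − (2s+1)|H|/n| < ε}` carrying a variance floor `cV·law₁ ≤ A^m_1` and a window
floor `LB ≤ law₁`, with the law mass off `B` as a raw tail. Here the three choices are made once and for all:
* `B := {y ∈ [2D+4, 2s+1] : |y − (2s+1)|H|/n| < ε}` (`Finset.filter` of `Icc`); once the floor `2D+4 ≤ (2s+1)|H|/n − ε` holds, every
  `y ∈ [0,t] ∖ B` deviates by `≥ ε` (`…GammaDirectionExpTools.le_abs_of_not_mem_window`), so Literature `ShellLawTail`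
  (`sum_sdiff_sum_levels_shellLaw_le`, Hoeffding by the method of types) prices the tail: `Σ_{y∉B}Σ_{j≤D} law_{2j+1}(y) ≤ (D+1)·2(n/2+1)³·e^{−ε²/|H|}`;
* the variance floor (V) := lit g39's `ShellLawLineSection.centredSq_law_ge_of_scale` (`V = (β/32)²·P⁸`, `N₀ = P⁸`, one smallness condition
  `256(√2(β/32)P⁴+2)² + 3ε + 3 ≤ β²P⁸`, plus the `HH` margin `βN₀ + 1 ≤ a`);
* the window floor := lit g39's `ShellLawWindowLowerBoundAFree.shellLaw_one_window_lower_afree_cell`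
  (`LB* = exp(−64(ε+11)²/(β⁵N₀))/(128N₀²)`, one smallness condition `4ε + 36 ≤ β³N₀`),
for ANY `0 < cV ≤ V` and `0 < LB ≤ LB*` (so the assembler may keep eng's spelling of `cV`, `LB` in the three smallness inequalities):

* **`gammaDirection_value_le_window`**: brick 142's hypotheses minus (`B`, `hB`, `hV`, `hLBl`), plus (`0 ≤ ε`, the floor, `βN₀+1 ≤ a`,
  `N₀ = P⁸`, the two smallness conditions, `cV ≤ V`, `LB ≤ LB*`) ⇒ brick 142's conclusion with the tail
  `2^{D+1}·G·(2n+3t)²·((D+1)·2(n/2+1)³·e^{−ε²/|H|})`.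
WHAT IS LEFT for the exp form (brick 143): `X_k` by type (brick 132), the remainder collapse (134a), and eng's numerics (`gamma_numerics`,
brick 143a) for every real hypothesis; then the `M`-average (brick 144). WHAT THIS FILE DOES NOT DO: those; anything on `TracialDecayExp20`
itself, psd rank of P_PM(K_n), or P vs NP.
[cite: Rothvoss2017, §2 (PDF p. 6)] [cite: Hoeffding1963, Thm. 2] [cite: RollinRoss2010, §4.1 Thm 4.2] [cite: ChattamvelliShanmugam2020, §7.4 (PDF p. 144)]
Stature: support/instrument (kernel lane, no defs, axioms standard; constants asymptotic only). Supports stmt-PneNP-19878.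
-/

set_option linter.dupNamespace false -- `Summit.PneNP.PneNP.…`: summit = sub-problem (D-0017)

noncomputable section

namespace Summit.PneNP.PneNP.Theorems.ChebyshevTracialDesignGammaDirectionExpWindow

open Finset Polynomial Literature.Barriers.PneNP Literature.Combinatorics.Optimization
open Literature.Combinatorics.Optimization.ShellStep
open Summit.PneNP.PneNP.Theorems.ChebyshevTracialDesignGammaDirectionDischarged (gammaDirection_value_le_discharged)
open Summit.PneNP.PneNP.Theorems.ChebyshevTracialDesignGammaDirectionExpTools (le_abs_of_not_mem_window mem_window)

variable {n : ℕ}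

set_option maxHeartbeats 400000 in -- ×2 head-room: brick 142's sixty hypotheses instantiated in one context
/-- **THE γ-DIRECTION VALUE BOUND ON THE FLOORED DEVIATION WINDOW (brick 143w).** Brick 142 with `B` := the floored window
`{y ∈ [2D+4, 2s+1] : |y − (2s+1)|H|/n| < ε}`, the variance floor := `centredSq_law_ge_of_scale` (`V = (β/32)²P⁸`), the window floor :=
`shellLaw_one_window_lower_afree_cell` (`LB* = exp(−64(ε+11)²/(β⁵N₀))/(128N₀²)`), for any `0 < cV ≤ V`, `0 < LB ≤ LB*`; the tail by
`ShellLawTail`. [cite: Rothvoss2017, §2 (PDF p. 6)] [cite: Hoeffding1963, Thm. 2] [cite: ChattamvelliShanmugam2020, §7.4 (PDF p. 144)] -/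
theorem gammaDirection_value_le_window {t T D : ℕ} {Bv : ℝ} {C : Finset ℕ} {w : ℕ → ℝ}
    (hdes : IsExactDesign n t T D Bv C w) (hDT : 2 * D + 1 ≤ T) (hT4 : T + 4 ≤ t) (h4t : 2 * (D + 1) + 4 ≤ t)
    (M : PMatch n) (H : Finset (Fin n)) (ψ : ℤ → ℝ) {G : ℝ} (hG0 : 0 ≤ G)
    (hψ0 : ∀ x ∈ Icc (0 : ℤ) (t : ℤ), 0 ≤ ψ x) (hψG : ∀ x ∈ Icc (0 : ℤ) (t : ℤ), ψ x ≤ G)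
    (gam lam kap : ℝ) (hgam : |gam| ≤ 1) (hlam : |lam| ≤ 1) (hkap : |kap| ≤ 1)
    {m : ℕ} (hm : 3 ≤ m) (hmn : m + 4 * (D + 1) + 4 ≤ n) (X : ℕ → ℝ) (hX0 : ∀ k, 0 ≤ X k)
    (hX : ∀ k, k ≤ D + 1 → ∀ r s : ℕ, r ≤ 2 → r ≤ s → s ≤ 2 * r → ∀ c' : ℕ, c' + 2 * k ≤ T →
      ∀ S' : Finset (Fin n), (∀ u ∈ S', M.2.partner u ∈ S') → S'.card + 4 * k + 2 * r = n →
      ∑ x ∈ Icc (0 : ℤ) ((t - s : ℕ) : ℤ),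
        |nab2^[k] (fun c x => shellLaw M.2.partner S' H (t - s - 2 * k) c x : Profile) c' x| ≤ X k)
    {s a a₂ b d N₀ N₁ N₂ s₁ s₂ r : ℕ} (ht : t = 2 * s + 1)
    (hN01 : N₁ + 1 = N₀) (hN12 : N₂ + 1 = N₁) (hs₁ : s₁ + 1 = s) (hs₂ : s₂ + 1 = s₁) (hr : r + 3 = s) (haa : a₂ + 2 = a)
    (ha : (reps M.2.partner (vAA M.2.partner univ H)).card = a)
    (hb : (reps M.2.partner (vBH M.2.partner univ H ∪ vBN M.2.partner univ H)).card = b)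
    (hd : (reps M.2.partner (vDD M.2.partner univ H)).card = d) (hN : a + b + d = N₀) (hn : n = 2 * N₀)
    {β : ℝ} (hβ : 0 < β) (hβ1 : β ≤ 1 / 4) (hD1 : 1 ≤ D) (hDN : 16 * D + 16 ≤ N₂)
    (hbβ : β * N₀ + 2 * D + 1 ≤ b) (hdβ : β * N₀ + 2 * D + 1 ≤ d)
    (hs : β * N₂ + D ≤ s₂) (hs' : 8 * (s : ℝ) ≤ (4 + β) * ((N₀ : ℝ) - 2 * D)) (hDs : D ≤ s₂) (hsn : 2 * s + 2 * D + 2 ≤ n)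
    {ε L : ℝ} (h2D : 2 * (D : ℝ) ≤ L) (hLN : 2 * L ≤ N₂)
    (hq1 : L + D + (ε + 8 + 14 * D + 1) ≤ β ^ 2 * N₂)
    (hq2 : L + D + (ε + 8 + 14 * D + 1) + 3 ≤ β * ((N₂ : ℝ) - 2 * D) / 8)
    (hq3 : 2 * (L + D + 1) ≤ (β ^ 2 / 8) ^ 2 * (β * ((N₂ : ℝ) - 2 * D)))
    (hq4 : 4 ≤ β * ((N₂ : ℝ) - 2 * D))
    (hq5 : (D : ℝ) * (1 + 8 * (L + D + 1) / ((β ^ 2 / 8) ^ 4 * (β * ((N₂ : ℝ) - 2 * D)))) ≤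
      (β ^ 2 / 8) ^ 4 * (β * ((N₂ : ℝ) - 2 * D)))
    {Lx : ℝ} (h2Lx : 2 ≤ Lx) (hLxN : Lx - 2 ≤ 2 * ((N₀ : ℝ) - 2))
    (hLx1 : Lx + 1 + (ε + 15) ≤ β * ((r : ℝ) + 2)) (hLx2 : Lx + 1 + (ε + 15) + 3 ≤ β * ((N₀ : ℝ) - 2) / 8)
    (hwin : 2 * (Lx + 1 + 1) ≤ (β ^ 2 / 8) ^ 2 * (β * ((N₀ : ℝ) - 2))) (hN4 : 4 ≤ β * ((N₀ : ℝ) - 2))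
    (hkV : (1 : ℝ) * (1 + 8 * (Lx + 1 + 1) / ((β ^ 2 / 8) ^ 4 * (β * ((N₀ : ℝ) - 2)))) ≤
      (β ^ 2 / 8) ^ 4 * (β * ((N₀ : ℝ) - 2)))
    {E Far : ℝ} (hE0 : 0 ≤ E) (hFar0 : 0 ≤ Far)
    (hE : (((1 + 8 * (Lx + 1 + 1) / ((β ^ 2 / 8) ^ 4 * (β * ((N₀ : ℝ) - 2)))) *
            (8 * (Lx + 1 + 1) / ((β ^ 2 / 8) ^ 4 * (β * ((N₀ : ℝ) - 2))) +
              2 * Real.sqrt 192 * Real.sqrt (2 * (2 * (1 : ℝ) + 1) *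
                (1 + 8 * (Lx + 1 + 1) / ((β ^ 2 / 8) ^ 4 * (β * ((N₀ : ℝ) - 2)))) /
                  ((β ^ 2 / 8) ^ 4 * (β * ((N₀ : ℝ) - 2)))))) ^ (2 * 1) *
          (1 + 4 * (Real.sqrt ((N₀ : ℝ) - 2) + 1) / 3 *
            (2 * Real.sqrt 192 * Real.sqrt (2 * (2 * (1 : ℝ) + 1) *
              (1 + 8 * (Lx + 1 + 1) / ((β ^ 2 / 8) ^ 4 * (β * ((N₀ : ℝ) - 2)))) /
                ((β ^ 2 / 8) ^ 4 * (β * ((N₀ : ℝ) - 2))))))) ≤ E)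
    (hFar : (4 : ℝ) ^ 1 * Real.exp (-((Lx - 2 * 1) ^ 2 / (4 * ((N₀ : ℝ) - 2)))) ≤ Far)
    {Γ q : ℝ}
    (hΓ₀ : (1 + 4 * (Real.sqrt N₀ + 1) / 3 *
          (2 * Real.sqrt 192 * Real.sqrt (2 * (2 * (D : ℝ) + 1) * (1 + 8 * (L + D + 1) / ((β ^ 2 / 8) ^ 4 * (β * ((N₀ : ℝ) - 2 * D)))) /
            ((β ^ 2 / 8) ^ 4 * (β * ((N₀ : ℝ) - 2 * D)))))) ≤ Γ)
    (hΓ₁ : (1 + 4 * (Real.sqrt N₁ + 1) / 3 *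
          (2 * Real.sqrt 192 * Real.sqrt (2 * (2 * (D : ℝ) + 1) * (1 + 8 * (L + D + 1) / ((β ^ 2 / 8) ^ 4 * (β * ((N₁ : ℝ) - 2 * D)))) /
            ((β ^ 2 / 8) ^ 4 * (β * ((N₁ : ℝ) - 2 * D)))))) ≤ Γ)
    (hΓ₂ : (1 + 4 * (Real.sqrt N₂ + 1) / 3 *
          (2 * Real.sqrt 192 * Real.sqrt (2 * (2 * (D : ℝ) + 1) * (1 + 8 * (L + D + 1) / ((β ^ 2 / 8) ^ 4 * (β * ((N₂ : ℝ) - 2 * D)))) /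
            ((β ^ 2 / 8) ^ 4 * (β * ((N₂ : ℝ) - 2 * D)))))) ≤ Γ)
    (hq₀ : (4 * ((1 + 8 * (L + D + 1) / ((β ^ 2 / 8) ^ 4 * (β * ((N₀ : ℝ) - 2 * D)))) *
          (8 * (L + D + 1) / ((β ^ 2 / 8) ^ 4 * (β * ((N₀ : ℝ) - 2 * D))) +
            2 * Real.sqrt 192 * Real.sqrt (2 * (2 * (D : ℝ) + 1) * (1 + 8 * (L + D + 1) / ((β ^ 2 / 8) ^ 4 * (β * ((N₀ : ℝ) - 2 * D)))) /
            ((β ^ 2 / 8) ^ 4 * (β * ((N₀ : ℝ) - 2 * D)))))) ^ 2 / (3 * β)) ≤ q)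
    (hq₁ : (4 * ((1 + 8 * (L + D + 1) / ((β ^ 2 / 8) ^ 4 * (β * ((N₁ : ℝ) - 2 * D)))) *
          (8 * (L + D + 1) / ((β ^ 2 / 8) ^ 4 * (β * ((N₁ : ℝ) - 2 * D))) +
            2 * Real.sqrt 192 * Real.sqrt (2 * (2 * (D : ℝ) + 1) * (1 + 8 * (L + D + 1) / ((β ^ 2 / 8) ^ 4 * (β * ((N₁ : ℝ) - 2 * D)))) /
            ((β ^ 2 / 8) ^ 4 * (β * ((N₁ : ℝ) - 2 * D)))))) ^ 2 / (3 * β)) ≤ q)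
    (hq₂ : (4 * ((1 + 8 * (L + D + 1) / ((β ^ 2 / 8) ^ 4 * (β * ((N₂ : ℝ) - 2 * D)))) *
          (8 * (L + D + 1) / ((β ^ 2 / 8) ^ 4 * (β * ((N₂ : ℝ) - 2 * D))) +
            2 * Real.sqrt 192 * Real.sqrt (2 * (2 * (D : ℝ) + 1) * (1 + 8 * (L + D + 1) / ((β ^ 2 / 8) ^ 4 * (β * ((N₂ : ℝ) - 2 * D)))) /
            ((β ^ 2 / 8) ^ 4 * (β * ((N₂ : ℝ) - 2 * D)))))) ^ 2 / (3 * β)) ≤ q)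
    (hqh : q ≤ 1 / 2)
    (hε0 : 0 ≤ ε) (hfloor : 2 * (D : ℝ) + 4 ≤ (2 * (s : ℝ) + 1) * H.card / n - ε)
    (haβ1 : β * N₀ + 1 ≤ a) {P : ℝ} (hP : (N₀ : ℝ) = P ^ 8)
    (hsmall : 256 * (Real.sqrt 2 * (β / 32) * P ^ 4 + 2) ^ 2 + 3 * ε + 3 ≤ β ^ 2 * P ^ 8)
    (hε36 : 4 * ε + 36 ≤ β ^ 3 * N₀)
    {cV LB : ℝ} (hcV : 0 < cV) (hLB : 0 < LB) (hcVle : cV ≤ (β / 32) ^ 2 * P ^ 8)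
    (hLBle : LB ≤ Real.exp (-(64 * (ε + 11) ^ 2 / (β ^ 5 * (N₀ : ℝ)))) / (128 * (N₀ : ℝ) ^ 2))
    (hεA : ((E * ((n : ℝ) * ((n : ℝ) - 2) / ((2 * (r : ℝ) + 6) * ((n : ℝ) - 2 * r - 8))) / 4 + 1 / ((r : ℝ) + 1)) +
          ((E * ((n : ℝ) * ((n : ℝ) - 2) / ((2 * (r : ℝ) + 6) * ((n : ℝ) - 2 * r - 8))) / 4 * (2 * (a : ℝ) ^ 2 / ((r : ℝ) + 1) + (2 * (a : ℝ) + 1) * a / ((r : ℝ) + 2)) +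
            (2 * (a : ℝ) + 1) * ((r : ℝ) + 3) / (2 * ((r : ℝ) + 2) * ((r : ℝ) + 1)) *
              ((a : ℝ) * (4 * Γ * q + (2 + 4 * Γ * q) / (2 * (r : ℝ) + 6))) +
            (a : ℝ) * (2 * (a : ℝ) + r + 3) / (2 * ((r : ℝ) + 2) * ((r : ℝ) + 1)) * (1 + 2 * Γ * q)) +
            (D : ℝ) * (2 * Γ * q ^ 2 * (a : ℝ) ^ 2 + 8 * (D : ℝ) * Γ * q * (a : ℝ) ^ 2 / (2 * (r : ℝ) + 6) +
            32 * (D : ℝ) ^ 2 * Γ * (a : ℝ) ^ 2 / ((2 * (r : ℝ) + 6) * (2 * (r : ℝ) + 4)) +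
            (2 * (a : ℝ) + 1) * a * (Γ * q ^ 2 + 4 * (D : ℝ) * Γ * q / (2 * (r : ℝ) + 6)))) / cV +
          ((((2 * (a : ℝ) + 1) * ((r : ℝ) + 3) / (2 * ((r : ℝ) + 2) * ((r : ℝ) + 1)) * (16 * (a : ℝ) / 3) +
            (a : ℝ) * (2 * (a : ℝ) + r + 3) / (2 * ((r : ℝ) + 2) * ((r : ℝ) + 1)) * (8 / 3)) +
              (D : ℝ) * (4 / 3 : ℝ) ^ D *
            ((a : ℝ) ^ 2 * ((2 * (r : ℝ) + 6) * (2 * (r : ℝ) + 4) / ((n : ℝ) * ((n : ℝ) - 2)) + 8 * (D : ℝ) * (2 * (r : ℝ) + 4) / ((n : ℝ) * ((n : ℝ) - 2)) +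
                32 * (D : ℝ) ^ 2 / ((n : ℝ) * ((n : ℝ) - 2)) + 1) +
              (2 * (a : ℝ) + 1) * a * ((2 * (r : ℝ) + 6 + 4 * D) / (n : ℝ)))) * Real.exp (-((L - 2 * D) ^ 2 / (4 * N₀))) +
            ((((r : ℝ) + 2 + a) ^ 2 + 2 * ((r : ℝ) + 2) ^ 2 / ((r : ℝ) + 1) + (2 * (a : ℝ) + 1)) / 4) * Far) / (LB * cV)) ≤ 3 / 4)
    (hεB : ∀ m : ℝ, 0 ≤ m → m ≤ a →
      (m * (Γ * (2 * q + 3 * D / s) + 2 * Γ * q) +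
          (D : ℝ) * (4 / 3 : ℝ) ^ D * ((2 * (s : ℝ) / n + 4 * D / n) * ((a : ℝ) * Real.exp (-((L - 2 * D) ^ 2 / (4 * N₀)))) + m * Real.exp (-((L - 2 * D) ^ 2 / (4 * N₀)))) / LB) /
        Real.sqrt cV ≤ 1 / 4)
    (hεC : (2 * Γ * q + (D : ℝ) * (4 / 3 : ℝ) ^ D * Real.exp (-((L - 2 * D) ^ 2 / (4 * N₀))) / LB) ≤ 1 / 4) :
    (Fintype.card (PMatch n) : ℝ) * ∑ U : OddSet n, levelWeight n t C w U M *
        (ψ ((U.1 ∩ H).card : ℤ) *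
          (∑ p : Fin n, (gam * (if (p ∈ H ∧ M.2.partner p ∈ H) then (1 : ℝ) else 0) +
              (lam * ((if (p ∈ H ∧ M.2.partner p ∈ H) then (1 : ℝ) else 0) -
                (if (p ∉ H ∧ M.2.partner p ∉ H) then (1 : ℝ) else 0)) + (lam + kap))) *
            ((if p ∈ U.1 then (1 : ℝ) else 0) * (if M.2.partner p ∈ U.1 then (1 : ℝ) else 0))) ^ 2) ≤
      -- R₁₂₀ (brick 120)
      (-- R₀
      Bv * ((((T - 1) / 2).choose (D + 1) : ℕ) : ℝ) *
          ((9 * (t : ℝ) ^ 2 * G) * (((m : ℝ) / (4 * ((m : ℝ) - 2))) ^ (D + 1) * X (D + 1))) +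
      -- 2 R₁
      2 * ((2 * (D : ℝ) + 1) * ((((2 * D).choose D : ℕ) : ℝ) / (4 : ℝ) ^ D) *
            ((3 * (t : ℝ) * G) * (((m : ℝ) / (4 * ((m : ℝ) - 2))) ^ D * X D)) +
          Bv * ((((T - 1) / 2).choose (D + 1) : ℕ) : ℝ) *
            ((T : ℝ) * ((3 * (t : ℝ) * G) * (((m : ℝ) / (4 * ((m : ℝ) - 2))) ^ (D + 1) * X (D + 1))) +
              2 * ((D : ℝ) + 1) * ((3 * (t : ℝ) * G) * (((m : ℝ) / (4 * ((m : ℝ) - 2))) ^ D * X D)))) +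
      -- R₂
      ((2 * (D : ℝ) + 1) * ((((2 * D).choose D : ℕ) : ℝ) / (4 : ℝ) ^ D) *
          ((T : ℝ) * (G * (((m : ℝ) / (4 * ((m : ℝ) - 2))) ^ D * X D)) +
            2 * (D : ℝ) * (G * (((m : ℝ) / (4 * ((m : ℝ) - 2))) ^ (D - 1) * X (D - 1)))) +
        Bv * ((((T - 1) / 2).choose (D + 1) : ℕ) : ℝ) *
          ((T : ℝ) * ((T : ℝ) * (G * (((m : ℝ) / (4 * ((m : ℝ) - 2))) ^ (D + 1) * X (D + 1))) +
              2 * ((D : ℝ) + 1) * (G * (((m : ℝ) / (4 * ((m : ℝ) - 2))) ^ D * X D))) +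
            2 * ((D : ℝ) + 1) * ((T : ℝ) * (G * (((m : ℝ) / (4 * ((m : ℝ) - 2))) ^ D * X D)) +
              2 * (D : ℝ) * (G * (((m : ℝ) / (4 * ((m : ℝ) - 2))) ^ (D - 1) * X (D - 1)))))) +
      -- 4 R₃
      4 * ((2 * (D : ℝ) + 1) * ((((2 * D).choose D : ℕ) : ℝ) / (4 : ℝ) ^ D) *
            (((H.card : ℝ) / n) * ((3 * (t : ℝ) * G) * (((m : ℝ) / (4 * ((m : ℝ) - 2))) ^ D * X D))) +
          Bv * ((((T - 1) / 2).choose (D + 1) : ℕ) : ℝ) *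
            ((T : ℝ) * (((H.card : ℝ) / n) * ((3 * (t : ℝ) * G) *
                (((m : ℝ) / (4 * ((m : ℝ) - 2))) ^ (D + 1) * X (D + 1)))) +
              2 * ((D : ℝ) + 1) * (((H.card : ℝ) / n) * ((3 * (t : ℝ) * G) *
                (((m : ℝ) / (4 * ((m : ℝ) - 2))) ^ D * X D))))) +
      -- 4 R₄
      4 * ((2 * (D : ℝ) + 1) * ((((2 * D).choose D : ℕ) : ℝ) / (4 : ℝ) ^ D) *
            ((T : ℝ) * (((H.card : ℝ) / n) * (G * (((m : ℝ) / (4 * ((m : ℝ) - 2))) ^ D * X D))) +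
              2 * (D : ℝ) * (((H.card : ℝ) / n) * (G * (((m : ℝ) / (4 * ((m : ℝ) - 2))) ^ (D - 1) * X (D - 1))))) +
          Bv * ((((T - 1) / 2).choose (D + 1) : ℕ) : ℝ) *
            ((T : ℝ) * ((T : ℝ) * (((H.card : ℝ) / n) * (G * (((m : ℝ) / (4 * ((m : ℝ) - 2))) ^ (D + 1) * X (D + 1)))) +
                2 * ((D : ℝ) + 1) * (((H.card : ℝ) / n) * (G * (((m : ℝ) / (4 * ((m : ℝ) - 2))) ^ D * X D)))) +
              2 * ((D : ℝ) + 1) * ((T : ℝ) * (((H.card : ℝ) / n) * (G * (((m : ℝ) / (4 * ((m : ℝ) - 2))) ^ D * X D))) +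
                2 * (D : ℝ) * (((H.card : ℝ) / n) * (G * (((m : ℝ) / (4 * ((m : ℝ) - 2))) ^ (D - 1) * X (D - 1))))))) +
      -- 4 R₅
      4 * ((2 * (D : ℝ) + 1) * ((((2 * D).choose D : ℕ) : ℝ) / (4 : ℝ) ^ D) *
            (((H.card : ℝ) / n) * (G * (((m : ℝ) / (4 * ((m : ℝ) - 2))) ^ D * X D))) +
          Bv * ((((T - 1) / 2).choose (D + 1) : ℕ) : ℝ) *
            ((T : ℝ) * (((H.card : ℝ) / n) * (G * (((m : ℝ) / (4 * ((m : ℝ) - 2))) ^ (D + 1) * X (D + 1)))) +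
              2 * ((D : ℝ) + 1) * (((H.card : ℝ) / n) * (G * (((m : ℝ) / (4 * ((m : ℝ) - 2))) ^ D * X D))))) +
      -- 4 R₆
      4 * ((2 * (D : ℝ) + 1) * ((((2 * D).choose D : ℕ) : ℝ) / (4 : ℝ) ^ D) *
            (((H.card : ℝ) ^ 2 / ((n : ℝ) * ((n : ℝ) - 2))) * (G * ((T : ℝ) * (((m : ℝ) / (4 * ((m : ℝ) - 2))) ^ D * X D) +
              2 * (D : ℝ) * (((m : ℝ) / (4 * ((m : ℝ) - 2))) ^ (D - 1) * X (D - 1))))) +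
          Bv * ((((T - 1) / 2).choose (D + 1) : ℕ) : ℝ) *
            ((T : ℝ) * (((H.card : ℝ) ^ 2 / ((n : ℝ) * ((n : ℝ) - 2))) *
                (G * ((T : ℝ) * (((m : ℝ) / (4 * ((m : ℝ) - 2))) ^ (D + 1) * X (D + 1)) +
                  2 * ((D : ℝ) + 1) * (((m : ℝ) / (4 * ((m : ℝ) - 2))) ^ D * X D)))) +
              2 * ((D : ℝ) + 1) * (((H.card : ℝ) ^ 2 / ((n : ℝ) * ((n : ℝ) - 2))) *
                (G * ((T : ℝ) * (((m : ℝ) / (4 * ((m : ℝ) - 2))) ^ D * X D) +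
                  2 * (D : ℝ) * (((m : ℝ) / (4 * ((m : ℝ) - 2))) ^ (D - 1) * X (D - 1)))))))) +
      -- R₇ (brick 129c with G₂ = 16tG, |α| ≤ 4)
      Bv * ((((T - 1) / 2).choose (D + 1) : ℕ) : ℝ) *
        (16 * (t : ℝ) * G * ((t : ℝ) * (((m : ℝ) / (4 * ((m : ℝ) - 2))) ^ (D + 1) * X (D + 1)) + 2 * ((D : ℝ) + 1) * (((m : ℝ) / (4 * ((m : ℝ) - 2))) ^ D * X D)) +
          4 * (G * ((t : ℝ) * ((t : ℝ) * (((m : ℝ) / (4 * ((m : ℝ) - 2))) ^ (D + 1) * X (D + 1)) + 2 * ((D : ℝ) + 1) * (((m : ℝ) / (4 * ((m : ℝ) - 2))) ^ D * X D)) +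
            2 * ((D : ℝ) + 1) * ((t : ℝ) * (((m : ℝ) / (4 * ((m : ℝ) - 2))) ^ D * X D) + 2 * (D : ℝ) * (((m : ℝ) / (4 * ((m : ℝ) - 2))) ^ (D - 1) * X (D - 1)))))) +
      -- 12 R′ (bricks 129b)
      12 * ((2 * (D : ℝ) + 1) * ((((2 * D).choose D : ℕ) : ℝ) / (4 : ℝ) ^ D) *
          ((t : ℝ) * (G * (((m : ℝ) / (4 * ((m : ℝ) - 2))) ^ D * X D)) +
            2 * (D : ℝ) * (G * (((m : ℝ) / (4 * ((m : ℝ) - 2))) ^ (D - 1) * X (D - 1)))) +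
        Bv * ((((T - 1) / 2).choose (D + 1) : ℕ) : ℝ) *
          ((T : ℝ) * ((t : ℝ) * (G * (((m : ℝ) / (4 * ((m : ℝ) - 2))) ^ (D + 1) * X (D + 1))) +
              2 * ((D : ℝ) + 1) * (G * (((m : ℝ) / (4 * ((m : ℝ) - 2))) ^ D * X D))) +
            2 * ((D : ℝ) + 1) * ((t : ℝ) * (G * (((m : ℝ) / (4 * ((m : ℝ) - 2))) ^ D * X D)) +
              2 * (D : ℝ) * (G * (((m : ℝ) / (4 * ((m : ℝ) - 2))) ^ (D - 1) * X (D - 1)))))) +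
      ((2 : ℝ) ^ (D + 1) * G * (2 * (n : ℝ) + 3 * (t : ℝ)) ^ 2 *
        (((D : ℝ) + 1) * (2 * ((n : ℝ) / 2 + 1) ^ 3 * Real.exp (-(ε ^ 2 / H.card)))))
  := by
  subst ht
  have hπ : ∀ v, M.2.partner (M.2.partner v) = v := partner_partner M
  have hπ' : ∀ v, M.2.partner v ≠ v := partner_ne M
  have hst : ∀ v ∈ (univ : Finset (Fin n)), M.2.partner v ∈ univ := fun v _ => mem_univ _
  -- the type data in real form
  have hHab : (H.card : ℝ) = 2 * a + b := by
    have h := card_eq_two_mul_add_of_types hπ hπ' H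
    rw [ha, hb] at h; exact_mod_cast h
  have hnr : (n : ℝ) = 2 * N₀ := by exact_mod_cast hn
  have hD0 : (0 : ℝ) ≤ D := Nat.cast_nonneg _
  -- lit's cut hypotheses from brick 142's
  have hN₂r : (N₂ : ℝ) = (N₀ : ℝ) - 2 := by
    have : ((N₂ + 2 : ℕ) : ℝ) = N₀ := by exact_mod_cast (show N₂ + 2 = N₀ by omega)
    push_cast at this; linarith only [this]
  have hs₂r : (s₂ : ℝ) = (s : ℝ) - 2 := by
    have : ((s₂ + 2 : ℕ) : ℝ) = s := by exact_mod_cast (show s₂ + 2 = s by omega)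
    push_cast at this; linarith only [this]
  have hsl : β * N₀ ≤ s := by
    rw [hN₂r, hs₂r] at hs
    have hD1r : (1 : ℝ) ≤ D := by exact_mod_cast hD1
    nlinarith only [hs, hD1r, hβ1, hβ]
  have hsl' : 8 * (s : ℝ) ≤ (4 + β) * N₀ := by
    have : (4 + β) * ((N₀ : ℝ) - 2 * D) ≤ (4 + β) * N₀ := by nlinarith only [hD0, hβ]
    exact hs'.trans this
  -- the window set
  obtain ⟨B, hBdef⟩ : ∃ B : Finset ℤ, B = (Icc (2 * (D : ℤ) + 4) (((2 * s + 1 : ℕ) : ℤ))).filter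
      (fun y : ℤ => |(y : ℝ) - (2 * (s : ℝ) + 1) * H.card / n| < ε) := ⟨_, rfl⟩
  have hB : ∀ y ∈ B, (2 * (D : ℤ) + 4 ≤ y ∧ y ≤ ((2 * s + 1 : ℕ) : ℤ)) ∧
      |(y : ℝ) - (2 * (s : ℝ) + 1) * H.card / n| < ε := fun y hy => by
    rw [hBdef] at hy; exact mem_window hy
  -- each window point as a natural number in the Literature window currency
  have hwinB : ∀ y ∈ B, ∃ x : ℕ, (x : ℤ) = y ∧ |(x : ℝ) - (2 * s + 1) * (2 * a + b) / (2 * (N₀ : ℝ))| ≤ ε := by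
    intro y hy
    obtain ⟨⟨hy1, -⟩, hyε⟩ := hB y hy
    obtain ⟨x, rfl⟩ : ∃ x : ℕ, (x : ℤ) = y := ⟨y.toNat, Int.toNat_of_nonneg (by omega)⟩
    refine ⟨x, rfl, ?_⟩
    have e : (2 * (s : ℝ) + 1) * H.card / n = (2 * s + 1) * (2 * a + b) / (2 * (N₀ : ℝ)) := by rw [hHab, hnr]
    have h' : |((x : ℤ) : ℝ) - (2 * (s : ℝ) + 1) * H.card / n| < ε := hyε
    rw [e] at h'
    simpa only [Int.cast_natCast] using h'.le
  -- the variance floor (V), lit g39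
  have hV : ∀ y ∈ B, ∀ m : ℝ, cV * shellLaw M.2.partner univ H (2 * s + 1) 1 y ≤
      (∑ U ∈ ((shell M.2.partner (2 * s + 1) 1).filter fun U => ((U ∩ H).card : ℤ) = y),
        (((((reps M.2.partner (vAA M.2.partner univ H)).filter fun v => v ∈ U ∧ M.2.partner v ∈ U).card : ℕ) : ℝ) - m) ^ 2) /
        ((shell M.2.partner (2 * s + 1) 1).card : ℝ) := by
    intro y hy m
    obtain ⟨x, rfl, hx⟩ := hwinB y hy
    have key := centredSq_law_ge_of_scale hπ hπ' H ha hb hd hN hβ hβ1 haβ1 (by linarith only [hbβ, hD0])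
      (by linarith only [hdβ, hD0]) hsl hsl' hx hP hsmall m
    have hlaw : 0 ≤ shellLaw M.2.partner univ H (2 * s + 1) 1 (x : ℤ) := shellLaw_nonneg _ _ _ _ _
    exact (mul_le_mul_of_nonneg_right hcVle hlaw).trans key
  -- the window floor, lit g39
  have hLBl : ∀ y ∈ B, LB ≤ shellLaw M.2.partner univ H (2 * s + 1) 1 y := by
    intro y hy
    obtain ⟨x, rfl, hx⟩ := hwinB y hy
    exact hLBle.trans (shellLaw_one_window_lower_afree_cell hπ hπ' hst H ha hb hd hN hβ hβ1
      (by linarith only [hbβ, hD0]) (by linarith only [hdβ, hD0]) hsl hsl' hx hε36)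
  -- brick 142
  have h142 := gammaDirection_value_le_discharged hdes hDT hT4 h4t M H ψ hG0 hψ0 hψG gam lam kap hgam hlam hkap hm hmn X hX0 hX
    rfl hN01 hN12 hs₁ hs₂ hr haa ha hb hd hN hn hβ hβ1 hD1 hDN hbβ hdβ hs hs' hDs hsn h2D hLN hq1 hq2 hq3 hq4 hq5 h2Lx hLxN hLx1
    hLx2 hwin hN4 hkV hE0 hFar0 hE hFar hΓ₀ hΓ₁ hΓ₂ hq₀ hq₁ hq₂ hqh B hB hcV hLB hV hLBl hεA hεB hεC
  -- the tail off the window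
  have htr : (((2 * s + 1 : ℕ)) : ℝ) = 2 * (s : ℝ) + 1 := by push_cast; ring
  have htail := sum_sdiff_sum_levels_shellLaw_le hπ hπ' H (2 * s + 1) D hε0 (Icc (0 : ℤ) ((2 * s + 1 : ℕ) : ℤ)) B
    (fun x hx => by
      obtain ⟨hx1, hx2⟩ := mem_sdiff.1 hx
      rw [htr]
      rw [hBdef] at hx2
      exact le_abs_of_not_mem_window hx1 hx2 (by push_cast; linarith only [hfloor]))
  have hc : 0 ≤ (2 : ℝ) ^ (D + 1) * G * (2 * (n : ℝ) + 3 * (((2 * s + 1 : ℕ)) : ℝ)) ^ 2 := by positivity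
  have hmul := mul_le_mul_of_nonneg_left htail hc
  linarith only [h142, hmul]

end Summit.PneNP.PneNP.Theorems.ChebyshevTracialDesignGammaDirectionExpWindow

end
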